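/-
Copyright: the b2b-balaban cell (near-miss cell 7), T⁴-continuum fan-out, round-2 swarm seat t4-ne7b-formalise-leaf-09
(row S3 of the lineage t4-ne7b-p1's claim table `t4/b2b-balaban-t4-ne7b-p1/LEAVES-NE7b.md`; node U5c COUNT member).
Released under the licence of the surrounding project.
-/
import Summits.QuantumFields.BalabanUV.T4Continuum.Support.HistoryGenTimed
import Summits.QuantumFields.BalabanUV.T4Continuum.Support.HistoryAdmissible

/-!
# History genealogies, part 5: the bridge to the census carrier `HistoryAdmissible.PGen`

Summits-side support leaf of the T⁴-continuum cell (rung (B)+1 on a FINITE torus only; NOT infinite volume, NOT the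
mass gap, NOT the Clay statement; NOT a proof of the spine estimate NE7b).  Round-2 swarm `t4-ne7b-formalise-*`, row S3
(seat leaf-09); optional by the owner's ruling R-OWNER-22-4 («a bridge `Pedigree.toPGen` with `PGen.toGen (toPGen c) =
gen c` is welcome for XREAD but NOT required»).  [folklore] finite bookkeeping over the lineage's OWN carriers; nothing
printed is asserted; no `[cite:]` tag.

WHAT.  `chainJoin` (a chain of `PGen.join`s at one step) with `toGen_chainJoin`; `Pedigree.partPGen` ∕ `joinP` ∕
**`Pedigree.toPGen cell c : PGen γ`** (the component's physical genealogy in the owner's census carrier, root cells read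
off the birth payloads by `cell : π → γ`; WF recursion, `toPGen_eq`); **`toGen_toPGen : (P.toPGen cell c).toGen =
P.gen c`** for pedigrees whose renewed parts come from the previous step (`Timed.renew_step` of part 4) — so the
owner's census (`not_wf_toGen`, `TypeNodup`, `consistent_toGen`∕`wf_toGen`) and the swarm's instance speak about ONE
flat genealogy; `rootStep_toPGen`.  GLUE (v2): `joinInLife_chainJoin`, `renewAtReach_chainJoin`, and
**`timed_of_toPGen`** — the census carrier's `JoinInLife` ∕ `RenewAtReach` on `toPGen c` for every `c` (what row S1b's
realisation layer derives ∕ displays on `PGen`), plus `step ≤ K` and «renewed parts from the previous step», GIVE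
`Pedigree.Timed K (dictWT Prod.fst R n₁)` of part 4, hence `consistentT_genT` ∕ `wf_genT`.  §2 (decided): the owner's ruling R-OWNER-22-7 (α) — an all-new join booked one
step late — realised by ENCODING (the join enters the pedigree at the virtual step `s + 1`), since the landed `genT`
is append-only: `SanityAlpha` computes the genealogy `merge (born (3,0,1) 3) (born (3,0,2) 3) (4,2,0)`.

HONEST DEPENDENCY (cell): continuum YM on T⁴ ⇐ BetaPertH ∧ nine spine estimates (0/9 proved); BetaPertH ⇐ (D1) ∧ (D4)
∧ CAP+tail.  This file changes none of it.
-/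

open Finset
open Literature.MathematicalPhysics.QuantumFieldTheory.Balaban1983to89
open T4PersistenceDictionary T4TaggedShapeBanking
open Summit.QuantumFields.BalabanUV.T4Continuum.ZoneSkeleton
open Summit.QuantumFields.BalabanUV.T4Continuum.HistoryAdmissible

namespace Summit.QuantumFields.BalabanUV.T4Continuum.HistoryGen

/-! ## The bridge -/

section Bridge

variable {α π γ : Type*} (P : Pedigree α π) (cell : π → γ)

/-- a chain of `PGen.join`s at step `s` [folklore] -/
def chainJoin : PGen γ → List (PGen γ) → ℕ → PGen γ
  | A, [], _ => A
  | A, B :: Bs, s => chainJoin (PGen.join A B s) Bs s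

/-- the canonical label of a chain of joins is the merger chain of the labels [folklore] -/
theorem toGen_chainJoin (s : ℕ) : ∀ (A : PGen γ) (Bs : List (PGen γ)),
    (chainJoin A Bs s).toGen = chainMerge A.toGen (Bs.map PGen.toGen) fun _ => ((s, 2, 0) : PEv)
  | _, [] => rfl
  | A, B :: Bs => by rw [chainJoin, toGen_chainJoin s _ Bs, List.map_cons, chainMerge_cons]; rfl

namespace Pedigree

/-- the `PGen` of a part, given the `PGen`s `rec` of earlier components (renewal READY at the old part's step) [folklore] -/
def partPGen (c : α) (rec : α → PGen γ) : Part α π → PGen γ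
  | Part.new d x => PGen.birth (P.step c) d (cell x)
  | Part.old c' false => rec c'
  | Part.old c' true => PGen.renew (rec c') (P.step c')

variable {P cell}

/-- part `PGen`s depend on `rec` only through the old parts listed [folklore] -/
theorem map_partPGen_congr (c : α) {rec rec' : α → PGen γ} :
    ∀ {ps : List (Part α π)}, (∀ c' r, Part.old c' r ∈ ps → rec c' = rec' c') →
      ps.map (P.partPGen cell c rec) = ps.map (P.partPGen cell c rec')
  | [], _ => rfl
  | p :: ps, h => by
      rw [List.map_cons, List.map_cons, map_partPGen_congr c fun c' r hm => h c' r (List.mem_cons_of_mem _ hm)]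
      congr 1
      rcases p with ⟨c', _ | _⟩ | ⟨d, x⟩
      · exact h c' false List.mem_cons_self
      · simp only [partPGen]; rw [h c' true List.mem_cons_self]
      · rfl

variable (P cell)

/-- the labels of the part `PGen`s are the flat part genealogies (renewed parts from the previous step) [folklore] -/
theorem map_toGen_partPGen (c : α) {rec : α → PGen γ} {rec' : α → Gen (Lab α π)}
    (hrec : ∀ c' r, Part.old c' r ∈ P.parts c → (rec c').toGen = gmap Prod.fst (rec' c'))
    (hS : ∀ c', Part.old c' true ∈ P.parts c → P.step c' + 1 = P.step c) :
    ∀ (i : ℕ) (ps : List (Part α π)), (∀ q ∈ ps, q ∈ P.parts c) →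
      (ps.map (P.partPGen cell c rec)).map PGen.toGen = (P.partsGenAux c rec' i ps).map (gmap Prod.fst)
  | _, [], _ => rfl
  | i, q :: ps, hsub => by
      rw [List.map_cons, List.map_cons, partsGenAux_cons, List.map_cons,
        map_toGen_partPGen c hrec hS (i + 1) ps fun q' hq' => hsub q' (List.mem_cons_of_mem _ hq')]
      congr 1
      have hq := hsub q List.mem_cons_self
      rcases q with ⟨c', _ | _⟩ | ⟨d, x⟩
      · exact hrec c' false hq
      · simp only [partPGen, PGen.toGen, partGen, gmap, hrec c' true hq, hS c' hq]
      · rfl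

variable [Inhabited γ]

/-- joining the parts' `PGen`s at the step of `c` (junk birth for a partless component) [folklore] -/
def joinP (c : α) : List (PGen γ) → PGen γ
  | [] => PGen.birth (P.step c) 0 default
  | A :: As => chainJoin A As (P.step c)

/-- **THE `PGen` OF A COMPONENT** read off the pedigree (well-founded recursion on the step). [folklore] -/
def toPGen (c : α) : PGen γ :=
  P.joinP c ((P.parts c).map (P.partPGen cell c fun c' =>
    if _h : P.step c' < P.step c then toPGen c' else PGen.birth (P.step c) 0 default))
termination_by P.step c
decreasing_by exact _h

/-- unfolding of `toPGen` [folklore] -/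
theorem toPGen_eq (c : α) :
    P.toPGen cell c = P.joinP c ((P.parts c).map (P.partPGen cell c (P.toPGen cell))) := by
  rw [toPGen, map_partPGen_congr c fun c' r hm => dif_pos (P.step_lt c c' r hm)]

/-- **ONE SHAPE FUNCTION, BRIDGE FORM**: the census carrier's canonical label of the component's `PGen` IS the flat
genealogy — for pedigrees whose renewed parts come from the previous step (`Timed.renew_step`). [folklore] -/
theorem toGen_toPGen (hS : ∀ c c', Part.old c' true ∈ P.parts c → P.step c' + 1 = P.step c) (c : α) :
    (P.toPGen cell c).toGen = P.gen c := by
  rw [toPGen_eq, gen, genT_eq]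
  unfold partsGen
  have key := P.map_toGen_partPGen cell c (rec := P.toPGen cell) (rec' := P.genT)
    (fun c' r hm => by
      have hlt := P.step_lt c c' r hm
      exact toGen_toPGen hS c')
    (hS c) 0 (P.parts c) fun q hq => hq
  cases hps : P.parts c with
  | nil => rfl
  | cons p ps =>
      rw [hps] at key
      simp only [List.map_cons, partsGenAux_cons, List.cons.injEq] at key
      simp only [joinP, join, List.map_cons, partsGenAux_cons]
      rw [toGen_chainJoin, gmap_chainMerge, key.1, key.2]
      rfl
termination_by P.step c
decreasing_by exact hlt

/-- hence the census carrier's root step is the genealogy's [folklore] -/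
theorem rootStep_toPGen (hS : ∀ c c', Part.old c' true ∈ P.parts c → P.step c' + 1 = P.step c) (c : α) :
    (P.toPGen cell c).rootStep = (P.genT c).rootStep := by
  rw [← PGen.rootStep_toGen, P.toGen_toPGen cell hS, rootStep_gen]

end Pedigree

end Bridge

/-! ## Glue: the census carrier's timing predicates on `toPGen` give `Pedigree.Timed` (for S1b's PGen-view facts) -/

section Glue

variable {α π γ : Type*}

/-- `JoinInLife` along a chain of joins: every member keeps it, and — if the chain is a real join — every member is
pending at the join step [folklore] -/
theorem joinInLife_chainJoin (W : PEv → ℕ) (s : ℕ) : ∀ (A : PGen γ) (Bs : List (PGen γ)),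
    (chainJoin A Bs s).JoinInLife W →
      A.JoinInLife W ∧ (∀ B ∈ Bs, B.JoinInLife W ∧ s < B.toGen.reach W) ∧ (Bs ≠ [] → s < A.toGen.reach W)
  | A, [], hJ => ⟨hJ, fun _ h => by simp at h, fun h => absurd rfl h⟩
  | A, B :: Bs, hJ => by
      rw [chainJoin] at hJ
      obtain ⟨hAB, hBs, -⟩ := joinInLife_chainJoin W s (PGen.join A B s) Bs hJ
      simp only [PGen.JoinInLife] at hAB
      obtain ⟨hA, hB, hsA, hsB⟩ := hAB
      refine ⟨hA, fun B' hB' => ?_, fun _ => hsA⟩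
      rcases List.mem_cons.1 hB' with rfl | hB'
      · exact ⟨hB, hsB⟩
      · exact hBs B' hB'

/-- `RenewAtReach` along a chain of joins: every member keeps it [folklore] -/
theorem renewAtReach_chainJoin (W : PEv → ℕ) (s : ℕ) : ∀ (A : PGen γ) (Bs : List (PGen γ)),
    (chainJoin A Bs s).RenewAtReach W → A.RenewAtReach W ∧ ∀ B ∈ Bs, B.RenewAtReach W
  | A, [], hR => ⟨hR, fun _ h => by simp at h⟩
  | A, B :: Bs, hR => by
      rw [chainJoin] at hR
      obtain ⟨hAB, hBs⟩ := renewAtReach_chainJoin W s (PGen.join A B s) Bs hR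
      simp only [PGen.RenewAtReach] at hAB
      refine ⟨hAB.1, fun B' hB' => ?_⟩
      rcases List.mem_cons.1 hB' with rfl | hB'
      · exact hAB.2
      · exact hBs B' hB'

namespace Pedigree

variable [Inhabited γ] {P : Pedigree α π} {cell : π → γ}

/-- members of the join of a nonempty list keep `RenewAtReach` [folklore] -/
theorem renewAtReach_of_mem_joinP (W : PEv → ℕ) {c : α} {L : List (PGen γ)} (h : (P.joinP c L).RenewAtReach W) :
    ∀ M ∈ L, M.RenewAtReach W := by
  intro M hM
  cases L with
  | nil => simp at hM
  | cons A As =>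
      obtain ⟨hA, hAs⟩ := renewAtReach_chainJoin W (P.step c) A As h
      rcases List.mem_cons.1 hM with rfl | hM
      · exact hA
      · exact hAs M hM

/-- members of the join of a list with at least two entries are pending at the join step under `JoinInLife` [folklore] -/
theorem lt_reach_of_mem_joinP (W : PEv → ℕ) {c : α} {L : List (PGen γ)} (h : (P.joinP c L).JoinInLife W)
    (h2 : 2 ≤ L.length) : ∀ M ∈ L, P.step c < M.toGen.reach W := by
  intro M hM
  cases L with
  | nil => simp at hM
  | cons A As =>
      have hne : As ≠ [] := by rintro rfl; simp at h2
      obtain ⟨-, hAs, hA⟩ := joinInLife_chainJoin W (P.step c) A As h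
      rcases List.mem_cons.1 hM with rfl | hM
      · exact hA hne
      · exact (hAs M hM).2

/-- **S1b's PGen-VIEW TIMING FACTS GIVE `Pedigree.Timed`.**  If every component is observed by the cutoff, renewed parts
come from the previous step, and the census carrier's `JoinInLife` ∕ `RenewAtReach` hold for the `PGen` of every
component (what the realisation layer derives ∕ displays on `PGen`), then the pedigree is `Timed` for the tagged
table — so `consistentT_genT` ∕ `wf_genT` (part 4) apply. [folklore] -/
theorem timed_of_toPGen (R : ℕ → ℕ) (n₁ K : ℕ) (hK : ∀ c, P.step c ≤ K)
    (hS : ∀ c c', Part.old c' true ∈ P.parts c → P.step c' + 1 = P.step c)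
    (hJ : ∀ c, (P.toPGen cell c).JoinInLife (dictW R n₁))
    (hR : ∀ c, (P.toPGen cell c).RenewAtReach (dictW R n₁)) : P.Timed K (dictWT Prod.fst R n₁) where
  step_le := hK
  renew_step := hS
  renew_reach c c' h := by
    have hRc := hR c
    rw [toPGen_eq] at hRc
    have hmem : P.partPGen cell c (P.toPGen cell) (Part.old c' true) ∈
        (P.parts c).map (P.partPGen cell c (P.toPGen cell)) := List.mem_map_of_mem h
    have hM := renewAtReach_of_mem_joinP (dictW R n₁) hRc _ hmem
    simp only [partPGen, PGen.RenewAtReach] at hM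
    rw [P.toGen_toPGen cell hS c', reach_gen] at hM
    rw [← hS c c' h]
    exact hM.2
  alive c c' h h2 := by
    have hJc := hJ c
    rw [toPGen_eq] at hJc
    have hmem : P.partPGen cell c (P.toPGen cell) (Part.old c' false) ∈
        (P.parts c).map (P.partPGen cell c (P.toPGen cell)) := List.mem_map_of_mem h
    have hM := lt_reach_of_mem_joinP (dictW R n₁) hJc (by simpa using h2) _ hmem
    simp only [partPGen] at hM
    rwa [P.toGen_toPGen cell hS c', reach_gen] at hM

end Pedigree

end Glue

/-! ## Ruling (α) by ENCODING: an all-new join enters at the VIRTUAL STEP `s + 1` (decided)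

The owner's ruling R-OWNER-22-7 (α) books an ALL-NEW join (every constituent born AT the join step `s`) at `s + 1`.
The landed `genT` dates the mergers of a component at the component's step and cannot be mutated (gate: append-only),
so (α) is realised by the SUPPLIER'S ENCODING, with no carrier change: the new regions of step `s` are single-part
components of step `s`, and their all-new join is a component of step `s + 1` whose parts are those components,
continued (`old cᵢ false`), in contact order.  Its genealogy is then LITERALLY the genealogy of (α) — births dated `s`,
the merger label `((s+1, 2, 0), mer c i)` — and `HeadOldest` (head root step `s < s + 1`) and `Timed.alive`
(`s + 1 < s + fatWait + R_s + 1`) hold for it; a group joined AGAIN at the physical step `s + 1` enters that join's part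
list directly (one chain at `s + 1`).  At the cutoff `K = s` the group is young and unbooked, as ruled. [folklore] -/

namespace SanityAlpha

/-- parts: components `0`, `1` = single new regions (classes 1, 2; payloads 5, 9) of step 3; component `2` = their
ALL-NEW join, entered at the VIRTUAL STEP 4 with the two single-region components as old plain parts [folklore] -/
def partsα : ℕ → List (Part ℕ ℕ)
  | 0 => [Part.new 1 5]
  | 1 => [Part.new 2 9]
  | 2 => [Part.old 0 false, Part.old 1 false]
  | _ => []

/-- steps: the regions at `3`, the virtual join component at `4` [folklore] -/
def stepα : ℕ → ℕ
  | 0 => 3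
  | 1 => 3
  | _ => 4

/-- old parts are earlier [folklore] -/
theorem stepα_lt : ∀ c c' r, Part.old c' r ∈ partsα c → stepα c' < stepα c := by
  intro c c' r h
  match c with
  | 0 => simp [partsα] at h
  | 1 => simp [partsα] at h
  | 2 =>
      simp [partsα] at h
      rcases h with ⟨rfl, -⟩ | ⟨rfl, -⟩ <;> decide
  | n + 3 => simp [partsα] at h

/-- the pedigree of the all-new join of two regions of step `3`, encoded at the virtual step `4` [folklore] -/
def Pα : Pedigree ℕ ℕ := ⟨stepα, partsα, stepα_lt⟩

/-- **(α) BY ENCODING**: the flat genealogy is `merge (born (3,0,1) 3) (born (3,0,2) 3) (4,2,0)` — births at the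
physical step `3`, the merger booked at `4 = 3 + 1`. [folklore] -/
theorem gen_allNew_virtualStep : Pα.gen 2 = Gen.merge (Gen.born (3, 0, 1) 3) (Gen.born (3, 0, 2) 3) (4, 2, 0) := by
  have h0 : Pα.genT 0 = Gen.born ((3, 0, 1), Tag.birth 0 0 1 5) 3 := by
    rw [Pedigree.genT_eq]; rfl
  have h1 : Pα.genT 1 = Gen.born ((3, 0, 2), Tag.birth 1 0 2 9) 3 := by
    rw [Pedigree.genT_eq]; rfl
  have h2 : Pα.genT 2 = Gen.merge (Pα.genT 0) (Pα.genT 1) ((4, 2, 0), Tag.mer 2 0) := by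
    rw [Pedigree.genT_eq]; rfl
  rw [Pedigree.gen, h2, h0, h1]; rfl

end SanityAlpha

end Summit.QuantumFields.BalabanUV.T4Continuum.HistoryGen
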